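import Summits.BirchSwinnertonDyer.BirchSwinnertonDyer.Theses.TwoAdicConverse
import Summits.BirchSwinnertonDyer.BirchSwinnertonDyer.Theorems.TwoAdicConverseLambdaHalfBridge
import HarnessLib

/-!
# Route `TwoAdicConverse` (rung S3): the re-split crux `OrdLambdaHalfAtTwo` (item 19556) IS the named `λ`-half leaf —
# `Iff.rfl` bridge, per-curve projection, and the weakening from the Eisenstein half

Cell `bsd-2adic` (run/shared/lean/pub/bsd-2adic/), seat `bsd-2adic-conv-1` (GEN 3). After the director's ruling
(2026-08-26T08:01Z) the planner re-split item 19218 (route rev 8–11): the new crux `Theses.TwoAdicConverse.OrdLambdaHalfAtTwo`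
(item 19556) is WRITTEN OUT in the route file (rev 9, for staffability) with exactly the body of conv-1's closed leaf
`Theorems.TwoAdicTwistConverse.OrdLambdaHalfAtTwo` (p425465: `∀` non-CM good-ordinary `W`, `LambdaHalfAtTwo W`). THEOREMS
ONLY (bookkeeping, so that every landed theorem about the named leaf transfers to the item BY NAME):
* `ordLambdaHalfAtTwo_route_iff` — route decl ⟺ named leaf (`Iff.rfl`);
* `lambdaHalfAtTwo_of_ordLambdaHalfAtTwo_route` — the item at one curve is `LambdaHalfAtTwo W` (so p435018's eleven
  instances `lambdaHalfAtTwo_<label>`, all `N > 5000`, are BC5 witnesses of item 19556's per-curve predicate, and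
  p427789/p435018/companion files' bridges — main conjecture ⇒ leaf, closed-form certificate ⇒ leaf, twist habitat,
  Kato's Conj. 17.6 at `p = 2` ⟺ leaf — all read on the item);
* `ordLambdaHalfAtTwo_route_of_ordEisensteinHalfAtTwo` — PUBLISHED (19167) ∧ the Eisenstein half (route decl
  `OrdEisensteinHalfAtTwo`, item 19272, now ASIDE/HELD) ⟹ item 19556: the new crux is WEAKER than the old child
  (p427789 `ordLambdaHalfAtTwo_of_ordEisensteinHalfAtTwo` re-typed on the route decls).
Nothing asserted; item 19556 stays OPEN class-wide; BSD is not proved by any of this. PARTITION (D-0054): none — RANK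
axis (S3); companion formula cell X5@2 good-ord (B1·O1; 611 classes), owner bsd-2adic.
-/

set_option linter.dupNamespace false
set_option autoImplicit false

noncomputable section

open WeierstrassCurve Literature.NumberTheory.EllipticCurves Literature.NumberTheory.EllipticCurves.Rank1Residual

namespace Summit.BirchSwinnertonDyer.BirchSwinnertonDyer.Theorems.TwoAdicTwistConverse

/-- **Item 19556 ⟺ the named leaf** (`Iff.rfl`: the route decl is the leaf's body written out).
[cite: GreenbergVatsal2000, p. 4 (after Thm. (1.2)) (shape; p odd)] -/
theorem ordLambdaHalfAtTwo_route_iff :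
    Summit.BirchSwinnertonDyer.BirchSwinnertonDyer.Theses.TwoAdicConverse.OrdLambdaHalfAtTwo ↔ OrdLambdaHalfAtTwo :=
  Iff.rfl

/-- The named leaf ⟹ item 19556 (route decl, fully qualified). [cite: GreenbergVatsal2000, p. 4 (after Thm. (1.2)) (shape; p odd)] -/
theorem ordLambdaHalfAtTwo_route_of_leaf (h : OrdLambdaHalfAtTwo) :
    Summit.BirchSwinnertonDyer.BirchSwinnertonDyer.Theses.TwoAdicConverse.OrdLambdaHalfAtTwo :=
  h

/-- **Item 19556 at one curve is `LambdaHalfAtTwo W`** (per-curve projection; the BC5 currency of the item).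
[cite: GreenbergVatsal2000, p. 4 (after Thm. (1.2)) (shape; p odd)] -/
theorem lambdaHalfAtTwo_of_ordLambdaHalfAtTwo_route
    (h : Summit.BirchSwinnertonDyer.BirchSwinnertonDyer.Theses.TwoAdicConverse.OrdLambdaHalfAtTwo)
    (W : WeierstrassCurve ℚ) [W.IsElliptic] [W.IsGloballyMinimal] (hcm : ¬ W.HasCM) (hgo : GoodOrd W 2) :
    LambdaHalfAtTwo W :=
  h W hcm hgo

/-- **The new crux is WEAKER than the old child: PUBLISHED (item 19167) ∧ `OrdEisensteinHalfAtTwo` (item 19272, aside)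
⟹ item 19556** — p427789's `ordLambdaHalfAtTwo_of_ordEisensteinHalfAtTwo` (the `λ`-component of seat ord-3's
Greenberg–Vatsal equivalence, via p427196 `forall_lam_le_of_ordEisensteinHalfAtTwo`) re-typed on the route decls.
[cite: GreenbergVatsal2000, p. 4 (after Thm. (1.2))] [cite: SkinnerUrban2014, Conj. 3.6.8 (p. 45) (shape; p odd)] -/
theorem ordLambdaHalfAtTwo_route_of_ordEisensteinHalfAtTwo
    (hP : Summit.BirchSwinnertonDyer.BirchSwinnertonDyer.Theses.TwoAdicConverse.OrdConversePublishedInputsAtTwo)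
    (hE : Summit.BirchSwinnertonDyer.BirchSwinnertonDyer.Theses.TwoAdicConverse.OrdEisensteinHalfAtTwo) :
    Summit.BirchSwinnertonDyer.BirchSwinnertonDyer.Theses.TwoAdicConverse.OrdLambdaHalfAtTwo :=
  ordLambdaHalfAtTwo_of_ordEisensteinHalfAtTwo hP hE

end Summit.BirchSwinnertonDyer.BirchSwinnertonDyer.Theorems.TwoAdicTwistConverse

end
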